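import Mathlib.Analysis.SpecialFunctions.Pow.Real
import Mathlib.Order.Filter.AtTopBot.Basic
import Literature.Computability.Complexity.Circuit
import Literature.Computability.Complexity.Classes
import Literature.Computability.Complexity.CircuitClasses
import Literature.Computability.MetaComplexity.TruthTables
import Literature.Computability.MetaComplexity.NaturalProofs
import HarnessLib

-- provenance: harness21/H21/H21/Statements/PNP/NaturalProofs.lean @ 1293438 (interim HEAD d8f2665); M5 mechanical rewrite
/-!
# P vs NP: the natural proofs barrier (Razborov–Rudich)

Family `PNP` (statement item `PNPNaturalProofs` of `H21/Outlines/CplxMeta.md`, §3), target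
statement **pnp.S18**.

Source: A. Razborov, S. Rudich, *Natural proofs*, J. Comput. System Sci. 55 (1997) 24–35,
Theorem 4.1: "There is no lower bound proof which is `P/poly`-natural against `P/poly`, unless
for every `ε > 0` no pseudo-random generator family `Gₖ : {0,1}ᵏ → {0,1}²ᵏ` in `P/poly` has
hardness `H(Gₖ) ≥ 2^{k^ε}`." Equivalently (inventory text): a `P/poly`-constructive large
property useful against `P/poly` forces every PRG in `P/poly` to have hardness `≤ 2^{k^{o(1)}}`.

## Contents

* `natural_proofs_barrier` (**pnp.S18**): RR Thm. 4.1 in the weak, infinitely-often form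
  `∃ᶠ k, H(Gₖ) < ⌈2^{k^ε}⌉₊` (sorried; theorem in print).
* `not_isNatural_of_hard_prg` (**pnp.S18**, contrapositive, the form usually quoted): if some
  generator family in `P/poly` is `2^{k^ε}`-hard for all large `k`, then no combinatorial property
  is both `P/poly`-natural and useful against `P/poly` (real proof from the previous theorem).

## Design choices

* Quantifier form (outline review finding 3). "`G` is `2^{k^ε}`-hard" means
  `H(Gₖ) ≥ 2^{k^ε}` for all sufficiently large `k`; RR's conclusion *negates* this, giving the
  `∃ᶠ k in atTop` form, which is the bolded default. Since `prgHardness (G k) : ℕ∞` and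
  `(H : ℕ) < ⌈r⌉₊ ↔ (H : ℝ) < r` (`Nat.lt_ceil`), comparing with `⌈2^{k^ε}⌉₊` cast into `ℕ∞` is
  exact. We do not add the stronger `∀ᶠ k` variant.
* Vacuity (outline review finding 1). With the prelude's *per-length* usefulness
  (`IsUsefulAgainstSize`, `IsUsefulAgainstPPoly`) the hypotheses
  `IsNatural PPoly P ∧ IsUsefulAgainstPPoly P` are not satisfiable by a trivial `P`: naturalness
  gives a large sub-property, and largeness forces `P n ≠ ∅` for all large `n`
  (`IsLarge.nonempty_eventually`), where usefulness then demands genuinely hard functions. Hence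
  `natural_proofs_barrier` is exactly RR's conditional statement, not an artefact of an empty
  property; we deliberately do not use RR's sequence wording of usefulness.

Mathlib has no natural proofs, PRG hardness or circuit classes (grep `Razborov`, `natural proof`,
`pseudorandom`: nothing relevant); we use `Filter.atTop`, `Filter.Frequently/Eventually`,
`Nat.ceil`, `Real.rpow` and `ℕ∞`. From H21 we use `CombinatorialProperty`, `IsNatural`,
`IsUsefulAgainstPPoly`, `PRGFamily`, `PRGFamily.IsInPPoly`, `prgHardness` (G14 `NaturalProofs`)
and `PPoly` (G01 `CircuitClasses`). Everything lives in `namespace Literature.PNP`.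
-/

namespace Literature.Computability.Complexity

open _root_.Computability MetaComplexity Filter

/-- **pnp.S18** (natural proofs barrier; Razborov–Rudich 1997, Thm. 4.1: "There is no lower
bound proof which is `P/poly`-natural against `P/poly`, unless for every `ε > 0` no pseudo-random
generator family in `P/poly` has hardness `2^{k^ε}`"). If `P` is a `P/poly`-natural
combinatorial property useful against `P/poly`, then for every generator family
`G = (Gₖ : {0,1}ᵏ → {0,1}²ᵏ)` computable in `P/poly` and every `ε > 0`, the hardness `H(Gₖ)`
drops below `2^{k^ε}` for infinitely many `k` (i.e. `G` is not `2^{k^ε}`-hard). Weak `∃ᶠ` form,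
the literal negation of "`H(Gₖ) ≥ 2^{k^ε}` for all large `k`"; the hypotheses are jointly
non-vacuous by `IsLarge.nonempty_eventually` (see the module docstring). [cite: RazborovRudich1997, Thm. 4.1: "There is no lower bound proof] -/
def natural_proofs_barrier : Prop :=
  ∀ (P : CombinatorialProperty) (hN : IsNatural PPoly P) (hU : IsUsefulAgainstPPoly P) (G : PRGFamily) (hG : G.IsInPPoly) (ε : ℝ) (hε : 0 < ε),
    ∃ᶠ k : ℕ in atTop, prgHardness (G k) < (⌈(2 : ℝ) ^ ((k : ℝ) ^ ε)⌉₊ : ℕ∞)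

/-- **pnp.S18** (natural proofs barrier, contrapositive form; Razborov–Rudich 1997, Thm. 4.1, as
usually quoted: "if `2^{n^ε}`-hard pseudo-random generators (equivalently one-way functions)
computable in `P/poly` exist, then there is no `P/poly`-natural proof useful against `P/poly`").
If some generator family `G` in `P/poly` satisfies `H(Gₖ) ≥ 2^{k^ε}` for some `ε > 0` and all
sufficiently large `k`, then no combinatorial property is both `P/poly`-natural and useful against
`P/poly`. Immediate from `natural_proofs_barrier`. [cite: RazborovRudich1997, Thm. 4.1  as usually quoted: "if  2^{n^ε] -/
def not_isNatural_of_hard_prg : Prop :=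
  ∀ (h : ∃ G : PRGFamily, G.IsInPPoly ∧ ∃ ε : ℝ, 0 < ε ∧ ∀ᶠ k : ℕ in atTop, (⌈(2 : ℝ) ^ ((k : ℝ) ^ ε)⌉₊ : ℕ∞) ≤ prgHardness (G k)),
    ¬ ∃ P : CombinatorialProperty, IsNatural PPoly P ∧ IsUsefulAgainstPPoly P

/- interim proof relied on results that are now named facts (D-0014); demoted to a fact by the M5 import, proof preserved:
:= by
  rintro ⟨P, hN, hU⟩
  obtain ⟨G, hG, ε, hε, hk⟩ := h
  exact (natural_proofs_barrier P hN hU G hG ε hε) (hk.mono fun k hk' => not_lt.mpr hk')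
-/

end Literature.Computability.Complexity
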